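import Mathlib
import HarnessLib
import Summits.NavierStokesRegularity.NavierStokesRegularity.Theorems.PoloidalWindowDoorLrcModEntireQ4SonicSheetDataPackage
import Summits.NavierStokesRegularity.NavierStokesRegularity.Theorems.PoloidalWindowDoorLrcModEntireShearedSecondOrder

/-!
# Route `PoloidalWindowDoor`, item `LrcModEntire` (stmt-NavierStokesRegularity-20428), cell (Q4-sonic), slot `stub_Q4sonicLineNeg`, case I —
# S5 (data for `g`): ON THE SPACE–TIME WEB SHEET `g = ∂_eU₂` AND ITS NORMAL DERIVATIVE VANISH (`hg0`, `hg1` of the mixed-system template)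

Cell ns-regularity-ideate, helper seat ns-k2-port-2 g8 under the LEAD of item 20428 (ns-poloidal-K2-p3 g17, memo `T2B-g17.md` v4 §7 S5; template
`…SheetSystemMixed.eq_zero_of_mixedSystem_template`, hypotheses `hg0 : g(y,0) = 0`, `hg1 : ∂_mg(y,0) = 0`); `--supports stmt-NavierStokesRegularity-20428 --as helper`.

In ABSOLUTE time `t = −1+τ`: the moving shear of `…ShearedCoordinates` with offset `d(t,z) := n₀(t+1, 0, z)` (the space–time web function of
`…Q4TimeWebPackage.time_web_package_line`, `s`-free in case I) maps the sheet `{m = 0}` onto the web points; there `∇ₕU₂ = 0` (web criticality, conjunct 4 of the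
package block) and `D²U₂[e,·] = 0` (`…Q4SonicSheetDataPackage.sonic_sheet_data_of_package` (iv)).  Hence for `g = gST (uncurry U) e ∘ Φ`:
* ★ `cauchyData_g_of_package` — for every `y = (t,s,z)` with `|t+1| < δ′`, `|z| < δ′` (case I: sonic + parallel at every such time): **`g(y,0) = 0` and `∂_mg(y,0) = 0`**.
(The data `P = Q = 0` on the sheet are the `s`-free branch of S3(e), LEAD `…SheetDataRigidity`; not here.)
WHAT THIS IS NOT: not a claim about Navier–Stokes regularity; no stub is closed here; items 20428 / 19708 / 27893 OPEN.
-/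

noncomputable section

set_option linter.dupNamespace false
set_option linter.style.longLine false

namespace Summit.NavierStokesRegularity.NavierStokesRegularity.Theorems.PoloidalWindowDoorLrcModEntireSheetCauchyData

open Set Function Filter Topology Metric
open scoped RealInnerProductSpace InnerProductSpace ContDiff
open Literature.Analysis
open Summit.NavierStokesRegularity.NavierStokesRegularity.Theorems.LocalSineTubeDoorProfileAlignedWindowRigidityAncient
open Summit.NavierStokesRegularity.NavierStokesRegularity.Theorems.PoloidalWindowDoorPoloidalWindowRigidityWindow
open Summit.NavierStokesRegularity.NavierStokesRegularity.Theorems.PoloidalWindowDoorLrcModEntireSheetSystemUniqueness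
open Summit.NavierStokesRegularity.NavierStokesRegularity.Theorems.PoloidalWindowDoorLrcModEntireSheetFlattenTools
open Summit.NavierStokesRegularity.NavierStokesRegularity.Theorems.PoloidalWindowDoorLrcModEntireShearedCoordinates
open Summit.NavierStokesRegularity.NavierStokesRegularity.Theorems.PoloidalWindowDoorLrcModEntireShearedKinematics
open Summit.NavierStokesRegularity.NavierStokesRegularity.Theorems.PoloidalWindowDoorLrcModEntireShearedSecondOrder
open Summit.NavierStokesRegularity.NavierStokesRegularity.Theorems.PoloidalWindowDoorLrcModEntireQ4SonicSheetDataPackage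

variable {C : ℝ} {U : ℝ → E3 → E3} {R μ : ℝ → ℝ → ℝ} {σ r ρ δ' : ℝ} {e : E3} {n₀ : ℝ × ℝ × ℝ → ℝ} {κt : ℝ → ℝ → ℝ}

/-- ★ **`g = ∂_mg = 0` on the space–time web sheet (case I).**  See the module docstring; `d(t,z) = n₀(t+1,0,z)`, `g = gST (uncurry U) e ∘ shearMap e d`. -/
theorem cauchyData_g_of_package
    (hrate : FluidPDE.HasTypeITimeDecay C U) (hcont : ContinuousOn (uncurry U) (Iio (0 : ℝ) ×ˢ univ))
    (hmild : ∀ s t : ℝ, s < t → t < 0 → ∀ x, U t x = UnboundedOperators.heatExtension (U s) (t - s) x - FluidPDE.oseenDuhamel 1 s U U t x)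
    (hdiv : ∀ t < 0, FluidPDE.VectorCalculus.IsDivFree (U t))
    (hσ : σ = 1 ∨ σ = -1) (hμ3 : ContDiff ℝ 3 (uncurry μ))
    (hslabU : ∀ t : ℝ, |t + 1| < ρ → ∀ x : E3, |x 2| < ρ → ∀ b : Fin 3, b ≠ 2 →
      fderiv ℝ (U t) x (EuclideanSpace.single 2 1) b = μ t (x 2) * fderiv ℝ (U t) x (EuclideanSpace.single b 1) 2)
    (hδ'ρ : δ' ≤ ρ) (hδ'h : δ' < 1 / 2) (he2 : e 2 = 0) (hunit : e 0 ^ 2 + e 1 ^ 2 = 1)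
    (hpack : ∀ q : ℝ × ℝ × ℝ, |q.1| < δ' → |q.2.2| < δ' →
        n₀ q ∈ Ioo (-r) r ∧
        σ * U (-1 + q.1) (frameCLM e (q.2.1, n₀ q, q.2.2)) 2 = R q.1 q.2.2 ∧
        (∀ n ∈ Icc (-r) r, n ≠ n₀ q → σ * U (-1 + q.1) (frameCLM e (q.2.1, n, q.2.2)) 2 < R q.1 q.2.2) ∧
        (∀ w : E3, w 2 = 0 → fderiv ℝ (fun y => U (-1 + q.1) y 2) (frameCLM e (q.2.1, n₀ q, q.2.2)) w = 0) ∧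
        (∀ m : ℕ∞, ContDiffAt ℝ m n₀ q) ∧
        0 < κt q.1 q.2.2 ∧
        fderiv ℝ (fderiv ℝ (fun y => σ * U (-1 + q.1) y 2)) (frameCLM e (q.2.1, n₀ q, q.2.2)) e e +
            fderiv ℝ (fderiv ℝ (fun y => σ * U (-1 + q.1) y 2)) (frameCLM e (q.2.1, n₀ q, q.2.2)) (Jvec e) (Jvec e) =
          -κt q.1 q.2.2 ∧
        κt q.1 q.2.2 * (fderiv ℝ n₀ q ((0 : ℝ), (0 : ℝ), (1 : ℝ))) ^ 2 =
          (deriv (deriv (R q.1)) q.2.2 - μ (-1 + q.1) q.2.2 * κt q.1 q.2.2) * (1 + (fderiv ℝ n₀ q ((0 : ℝ), (1 : ℝ), (0 : ℝ))) ^ 2))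
    (hsonI : ∀ τ : ℝ, |τ| < δ' → ∃ A B : ℝ, ∀ z : ℝ, |z| < δ' → R τ z = A + B * z)
    (hparI : ∀ τ s z : ℝ, |τ| < δ' → |z| < δ' → n₀ (τ, s, z) = n₀ (τ, (0 : ℝ), z))
    {y : Y3} (hyt : |y.1 + 1| < δ') (hyz : |y.2.2| < δ') :
    (gST (uncurry U) e ∘ shearMap e (fun q : ℝ × ℝ => n₀ (q.1 + 1, (0 : ℝ), q.2))) (y, 0) = 0 ∧
      pd dN (gST (uncurry U) e ∘ shearMap e (fun q : ℝ × ℝ => n₀ (q.1 + 1, (0 : ℝ), q.2))) (y, 0) = 0 := by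
  set d : ℝ × ℝ → ℝ := fun q => n₀ (q.1 + 1, (0 : ℝ), q.2) with hd_def
  set t : ℝ := y.1 with ht_def
  set s : ℝ := y.2.1 with hs_def
  set z : ℝ := y.2.2 with hz_def
  set τ : ℝ := t + 1 with hτ_def
  have hτ : |τ| < δ' := hyt
  have hτt : -1 + τ = t := by rw [hτ_def]; ring
  have ht0 : t < 0 := by
    have h := (abs_lt.1 hyt).2
    linarith [hδ'h]
  -- the sheet data at time `τ`
  obtain ⟨hW, -, -, hee, -, -, -, -⟩ := sonic_sheet_data_of_package hrate hcont hmild hdiv hσ hμ3 hslabU hδ'ρ hδ'h he2 hunit hpack hτ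
    (hsonI τ hτ) (fun s' z' hz' => hparI τ s' z' hτ hz') s (z := z) hyz
  obtain ⟨-, -, -, hhor, -, -, -, -⟩ := hpack (τ, s, z) hτ hyz
  obtain ⟨-, -, -, -, hnC, -, -, -⟩ := hpack (τ, (0 : ℝ), z) hτ hyz
  simp only at hhor hnC
  rw [hτt] at hee hhor
  -- the web point is the image of the sheet point `(y, 0)`
  have hΦ : shearMap e d (y, 0) = (t, frameCLM e (s, n₀ (τ, s, z), z)) := by
    rw [hW]
    simp [shearMap, shearPt, hd_def, ht_def, hs_def, hz_def, hτ_def]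
  set Wp : E3 := frameCLM e (s, n₀ (τ, s, z), z) with hWp
  -- regularity
  set T : Set ℝ := Iio 0 with hT_def
  have hT : IsOpen T := isOpen_Iio
  have hA := isTypeIAncientMild_of_class hrate hcont hmild hdiv
  have hWs : ContDiffOn ℝ ∞ (uncurry U) (T ×ˢ (univ : Set E3)) := hA.contDiffOn
  have hsl : ContDiff ℝ ∞ (U t) := hA.contDiff_slice ht0
  have hθ2 : ContDiff ℝ 2 (fun x : E3 => U t x 2) :=
    ((contDiff_piLp_apply (p := 2) (𝕜 := ℝ) (E := fun _ : Fin 3 => ℝ) (i := (2 : Fin 3))).comp hsl).of_le (by norm_cast)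
  have hUd : Differentiable ℝ (U t) := hsl.differentiable (by simp)
  have hcoord : ∀ x w : E3, fderiv ℝ (U t) x w 2 = fderiv ℝ (fun x' : E3 => U t x' 2) x w := fun x w => by
    have h := ((EuclideanSpace.proj (𝕜 := ℝ) (2 : Fin 3)).hasFDerivAt.comp x (hUd x).hasFDerivAt).fderiv
    have e3 : (⇑(EuclideanSpace.proj (𝕜 := ℝ) (2 : Fin 3)) ∘ U t) = fun x' => U t x' 2 := by funext x'; simp
    rw [e3] at h
    rw [h]; rfl
  obtain ⟨-, hGd, -⟩ := gST_regular (e := e) hT hWs (q := (t, Wp)) ht0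
  have hdp : DifferentiableAt ℝ d (((y, (0 : ℝ)) : Y3 × ℝ).1.1, ((y, (0 : ℝ)) : Y3 × ℝ).1.2.2) := by
    show DifferentiableAt ℝ d (t, z)
    have hline : ContDiff ℝ ∞ (fun q : ℝ × ℝ => ((q.1 + 1, (0 : ℝ), q.2) : ℝ × ℝ × ℝ)) :=
      (contDiff_fst.add contDiff_const).prodMk (contDiff_const.prodMk contDiff_snd)
    have h1 : ContDiffAt ℝ ∞ n₀ ((fun q : ℝ × ℝ => ((q.1 + 1, (0 : ℝ), q.2) : ℝ × ℝ × ℝ)) (t, z)) := by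
      simpa [hτ_def] using hnC ⊤
    exact (h1.comp (t, z) hline.contDiffAt).differentiableAt (by simp)
  refine ⟨?_, ?_⟩
  · -- `g = ∂_eU₂ = 0` by horizontal criticality
    show gST (uncurry U) e (shearMap e d (y, 0)) = 0
    rw [hΦ, gST_slice hT hWs ht0 Wp]
    show fderiv ℝ (U t) Wp e 2 = 0
    rw [hcoord, hWp]
    exact hhor e he2
  · -- `∂_mg = D²U₂(W)[Je][e] = D²U₂(W)[e][Je] = 0` (null tangent `e`)
    have hG : DifferentiableAt ℝ (gST (uncurry U) e) (shearMap e d (y, 0)) := by rw [hΦ]; exact hGd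
    rw [pd_dN_comp_shearMap e d hG hdp, hΦ, fderiv_gST_space hT hWs ht0 Wp (Jvec e)]
    have hfun : (fun x : E3 => fderiv ℝ (fun x' : E3 => uncurry U (t, x')) x e 2) = fun x => fderiv ℝ (fun x' : E3 => U t x' 2) x e := by
      funext x; exact hcoord x e
    rw [hfun, nested_eq_fderiv_fderiv hθ2, (hθ2.contDiffAt.isSymmSndFDerivAt (by simp)) (Jvec e) e, hWp]
    exact hee (Jvec e)

end Summit.NavierStokesRegularity.NavierStokesRegularity.Theorems.PoloidalWindowDoorLrcModEntireSheetCauchyData
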